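import Literature.Topology.FourManifolds.CorkDecompositionMatveyevForm
import Literature.Topology.FourManifolds.HCobordismTheoremProofs
import HarnessLib

/-!
# The cork decomposition theorem from its two remaining leaves (B) and (H4)

Topic `Literature/Topology/FourManifolds` (fact seat
`provefact-Literature.Topology.FourManifolds.corkDe-d7453cb51b`, discharge file of the named fact
`Literature.Topology.FourManifolds.corkDecomposition` of `CorkTwist.lean`: Curtis–Freedman–Hsiang–Stong,
Invent. Math. 123 (1996), and Matveyev, *A decomposition of smooth simply-connected h-cobordant
4-manifolds*, J. Differential Geom. 44 (1996) 571–582, arXiv:dg-ga/9505001, Theorem 1 — two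
h-cobordant simply connected closed smooth 4-manifolds differ by a cork twist along a compact
contractible `W` with an involution of `∂W`).

The tree proves `corkDecomposition` along Matveyev's printed proof (pp. 1–3; Kirby, Turkish J.
Math. 20 (1996), §§2–4): part 2 of the Theorem from part 1 with Fact 1
(`corkDecomposition_of_partOne_and_fact`, `SeamAdaptedWitnesses.lean`; the printed two-piece form
`Matveyev1996_partOne_and_fact.matveyev1996_decomposition`, `CorkDecompositionMatveyevForm.lean`),
and part 1 with Fact 1 from three leaves (`corkDecomposition_of_eightOne_middleLevel`, ibid.):

1. the first sentence of the printed proof, *"`U` has a handlebody with no 1- and 4-handles"*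
   — Milnor's Thm. 8.1 at the incoming end of the simply connected 5-dimensional h-cobordism,
   `Literature.Topology.FourManifolds.Cobordism.Milnor1965_exists_isMorseFunction_two_le_index_left`,
   with the discharged Thms. 2.5 and 4.8 (`HCobordismHandlesTwoThree.lean`);
2. **(B)** the middle level of that two-three handlebody with its two algebraically dual framed
   families of 2-spheres, surgery along which gives the two ends (Kirby 1996 §2, last paragraph;
   Matveyev, Proof of Theorem, sentences 1–6; Milnor 1965 Thm. 3.13, Cor. 7.3, Thm. 7.6),
   `Literature.Topology.FourManifolds.exists_dualSpheres_middleLevel_of_two_three`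
   (`CorkDecompositionMiddleLevel.lean`);
3. **(H4)** the four-dimensional construction from the middle level on, with Fact 1 (Matveyev
   pp. 1–3; Kirby 1996 §3 and Addenda (B), (C)),
   `Literature.Topology.FourManifolds.Matveyev1996_partOne_and_fact_of_dualSpheres` (ibid.).

Leaf 1 has since been **discharged** by the h-cobordism files of the tree:
`Cobordism.Milnor1965_exists_isMorseFunction_two_le_index_left_holds`
(`HCobordismTheoremProofs.lean`; Milnor 1965, Thm. 8.1 and its proof, PDF pp. 54–57, the last
leaf being Assertion 6 of the proof of Thm. 5.4, `Cobordism.Milnor1965_cancellation_levelDeformation_holds`).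
This file records the resulting assembly: `corkDecomposition`, and the printed two-piece form
`Matveyev1996_decomposition`, follow from exactly the **two named facts that remain open below
them**, (B) and (H4) — each the subject of its own fact seat (`DualSphereFamiliesReorientation.lean`,
`CorkDecompositionMiddleLevelProofs.lean`).  When both are discharged, `corkDecomposition_holds`
is `corkDecomposition_of_middleLevel_leaves` applied to their `_holds`, to be appended here.
No statement (no `def`, no named fact) is introduced in this file (D-0026).

* `Literature.Topology.FourManifolds.matveyev1996_decomposition_of_middleLevel_leaves` —
  `Matveyev1996_decomposition ⟸ (B) ∧ (H4)`;
* `Literature.Topology.FourManifolds.corkDecomposition_of_middleLevel_leaves` —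
  `corkDecomposition ⟸ (B) ∧ (H4)`.

## References

* C. L. Curtis, M. H. Freedman, W. C. Hsiang, R. Stong, *A decomposition theorem for h-cobordant
  smooth simply-connected compact 4-manifolds*, Invent. Math. 123 (1996) 343–348. [CurtisFreedmanHsiangStong1996]
* R. Matveyev, *A decomposition of smooth simply-connected h-cobordant 4-manifolds*,
  J. Differential Geom. 44 (1996) 571–582; arXiv:dg-ga/9505001: Theorem 1, Proof of Theorem
  (pp. 1–3), Fact 1 (p. 3). [Matveyev1996]
* R. Kirby, *Akbulut's corks and h-cobordisms of smooth, simply connected 4-manifolds*, Turkish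
  J. Math. 20 (1996) 85–93; arXiv:math/9712231, §§2–4. [KirbyCorks1996]
* J. Milnor, *Lectures on the h-cobordism theorem*, notes by L. Siebenmann and J. Sondow,
  Princeton (1965): Thm. 8.1 and its proof (PDF pp. 54–57), proof of Thm. 9.1 (PDF p. 57).
  [MilnorHCobordism1965]
-/

noncomputable section

namespace Literature.Topology.FourManifolds

universe u

/-- **Matveyev's Theorem 1 (parts 1–2 minus the `H₂` clause) from its two remaining leaves (B)
and (H4).**  With Milnor's Thm. 8.1 at the incoming end of the simply connected 5-dimensional
h-cobordism discharged (`Cobordism.Milnor1965_exists_isMorseFunction_two_le_index_left_holds`,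
i.e. the first sentence of the printed proof, *"First, observe that `U` has a handlebody with no
1- and 4-handles"*, Matveyev p. 1, is a closed theorem of the tree),
`Literature.Topology.FourManifolds.Matveyev1996_decomposition` follows from the middle level of the
two-three handlebody (B) (`Literature.Topology.FourManifolds.exists_dualSpheres_middleLevel_of_two_three`)
and the four-dimensional construction from the middle level on with Fact 1 (H4)
(`Literature.Topology.FourManifolds.Matveyev1996_partOne_and_fact_of_dualSpheres`), by
`matveyev1996_decomposition_of_middleLevel` (`CorkDecompositionMatveyevForm.lean`).
[cite: Matveyev1996, Theorem 1 and its proof (arXiv pp. 1–3), Fact 1 (p. 3)]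
[cite: KirbyCorks1996, §§2–4: Theorem and Addenda (B), (C), (D)]
[cite: MilnorHCobordism1965, Thm. 8.1 and its proof (PDF pp. 54–57)] -/
theorem matveyev1996_decomposition_of_middleLevel_leaves
    (hB : exists_dualSpheres_middleLevel_of_two_three.{u})
    (h4 : Matveyev1996_partOne_and_fact_of_dualSpheres.{u}) : Matveyev1996_decomposition.{u} :=
  matveyev1996_decomposition_of_middleLevel
    Cobordism.Milnor1965_exists_isMorseFunction_two_le_index_left_holds hB h4

/-- **The cork decomposition theorem from its two remaining leaves (B) and (H4).**
`Literature.Topology.FourManifolds.corkDecomposition` (h-cobordant simply connected closed smooth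
4-manifolds `X₁ = M ∪_{id} W`, `X₂ = M ∪_τ W` with `W` compact contractible and `τ` an involution
of `∂W`) follows from (B) `Literature.Topology.FourManifolds.exists_dualSpheres_middleLevel_of_two_three`
and (H4) `Literature.Topology.FourManifolds.Matveyev1996_partOne_and_fact_of_dualSpheres` alone:
`corkDecomposition_of_eightOne_middleLevel` (`CorkDecompositionMatveyevForm.lean`) with its first
hypothesis, Milnor's Thm. 8.1 at the incoming end, discharged by
`Cobordism.Milnor1965_exists_isMorseFunction_two_le_index_left_holds`.  Once (B) and (H4) are
discharged, `corkDecomposition_holds` is this theorem applied to their `_holds`.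
[cite: CurtisFreedmanHsiangStong1996, Theorem] [cite: Matveyev1996, Theorem 1 and its proof (arXiv pp. 1–3)]
[cite: KirbyCorks1996, Theorem and Addenda (B)–(D)]
[cite: MilnorHCobordism1965, Thm. 8.1 and its proof (PDF pp. 54–57)] -/
theorem corkDecomposition_of_middleLevel_leaves
    (hB : exists_dualSpheres_middleLevel_of_two_three.{u})
    (h4 : Matveyev1996_partOne_and_fact_of_dualSpheres.{u}) : corkDecomposition.{u} :=
  corkDecomposition_of_eightOne_middleLevel
    Cobordism.Milnor1965_exists_isMorseFunction_two_le_index_left_holds hB h4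

end Literature.Topology.FourManifolds

end
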